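import Summits.Ventures.HSemireg.WedgeHankelRecurrenceGaussStieltjesParameters

/-!
# Venture HSemireg — **SYMMETRIZATION (Chihara's `S_{2n}(x) = P_n(x²)`)**: for parameters `c_1, c_2, …` let `S` be the SYMMETRIC recurrence `S_0 = 1`, `S_1 = X`, `S_{n+2} = X S_{n+1} − c_{n+1} S_n`,
# `q` the recurrence with `a_0 = c_1`, `a_{n+1} = c_{2n+2} + c_{2n+3}`, `b_{n+1} = c_{2n+1} c_{2n+2}` (Stieltjes ∕ birth–death data `λ_n = c_{2n+1}`, `μ_n = c_{2n}` of N373) and `k` the SHIFTED one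
# `a'_n = c_{2n+1} + c_{2n+2}`, `b'_{n+1} = c_{2n+2} c_{2n+3}`; then `q_{n+1} = X k_n − c_{2n+1} q_n`, `k_{n+1} = q_{n+1} − c_{2n+2} k_n` (so `k_n` are the monic KERNEL polynomials of `q` at `0`) and
# **`S_{2n} = q_n(X²)`, `S_{2n+1} = X · k_n(X²)`**; consequently `S_{2n} = ∏ (X − √z_i)(X + √z_i)` over the zeros `z_i ≥ 0` of `q_n`

HONEST FRAMING. Part of the Lean index of the computation cell `pub-hsemireg` (seat p10 gen 46, Sunday typer «UNIFORM-IN-n»).  Real polynomials only; no variety, no cohomology theory, no sheaf, no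
Ext group and no semiregularity map is constructed here; nothing here says that HC / HC_CM / HC_AV holds; no Literature fact (unproved `Prop`) is declared or used.  Custodian versions as in
`WedgeHankelSiegelIdeal` (1/3).
SOURCES (cited).  T. S. Chihara, *An Introduction to Orthogonal Polynomials* (1978), Ch. I §8 (symmetric OPS, Thm 8.1: `S_{2m}(x) = P_m(x²)`, `S_{2m+1}(x) = x K_m(x²)`) and §9, eq. (9.1)–(9.6)
(the relations between the coefficients); T. J. Stieltjes, *Recherches sur les fractions continues* (1894) (even ∕ odd contraction of the S-fraction); H. S. Wall, *Analytic Theory of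
Continued Fractions* (1948) §28; G. Szegő, *Orthogonal Polynomials*, §2.3 (2.3.3) and (5.6.1) (Hermite ↔ Laguerre `±½`).
PROOF TYPED HERE.  Simultaneous induction on `n` for the pair of identities `q_{n+1} = X k_n − c_{2n+1} q_n`, `k_{n+1} = q_{n+1} − c_{2n+2} k_n` (ring algebra from the three recurrences);
then `S_{2n+2} = X · S_{2n+1} − c_{2n+1} S_{2n} = X² k_n(X²) − c_{2n+1} q_n(X²) = q_{n+1}(X²)` and `S_{2n+3} = X (q_{n+1} − c_{2n+2} k_n)(X²) = X k_{n+1}(X²)` by `comp`; the factorisation from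
`X² − z = (X − √z)(X + √z)` for `z ≥ 0`.
DEDUP DISCLOSURE (`rg -n -i 'symmetriz|comp \\(Polynomial.X \\^ 2\\)|S_{2n}' Summits/Ventures/HSemireg`, 2026-09-03): N340 `symmetric_recurrence_parity ∕ _zeros_symm` treat a symmetric recurrence
on its own (parity, `±` zeros); the contraction to `q_n(X²)` is new.  The 4 names below: 0 hits tree-wide.

WHAT IS IN THE TREE.  N340 `symmetric_recurrence_zeros_symm`; N373 (birth–death data); Mathlib `Polynomial.comp`, `Real.mul_self_sqrt`.
THIS FILE (namespace `Summit.Ventures.HSemireg.Wedge.HankelOuter` continued; CHAINED on N373 (import only); 0 definitions):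
* §1139 **`stieltjes_kernel_identities`** (`q_{n+1} = X k_n − c_{2n+1} q_n`, `k_{n+1} = q_{n+1} − c_{2n+2} k_n`), **`symmetrization_even_odd`** (`S_{2n} = q_n(X²)`, `S_{2n+1} = X k_n(X²)`),
  `comp_X_sq_prod_eq` (`(∏ (X − z_i))(X²) = ∏ (X − √z_i) · ∏ (X + √z_i)` for `z_i ≥ 0`), **`symmetrization_even_zeros`** (`S_{2n} = ∏ (X − √z_i) ∏ (X − (−√z_i))`).
CAVEATS.  Pure recurrence algebra; positivity of the `c_n` is not needed for the identities (only `z_i ≥ 0` for the factorisation).  Nothing Ext-side.  New names only.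
-/

open Module Polynomial
open scoped Matrix Polynomial

namespace Summit.Ventures.HSemireg.Wedge.HankelOuter

/-! ## §1139. Symmetrization -/

/-- **The contraction identities: `q_{n+1} = X k_n − c_{2n+1} q_n` and `k_{n+1} = q_{n+1} − c_{2n+2} k_n`** for the recurrences `q` (`a_0 = c_1`, `a_{n+1} = c_{2n+2} + c_{2n+3}`,
`b_{n+1} = c_{2n+1} c_{2n+2}`) and `k` (`a'_n = c_{2n+1} + c_{2n+2}`, `b'_{n+1} = c_{2n+2} c_{2n+3}`). [Chihara I (9.3)–(9.6); this file, §1139] -/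
theorem stieltjes_kernel_identities {q k : ℕ → ℝ[X]} {a b a' b' c : ℕ → ℝ} (hq0 : q 0 = 1) (hq1 : q 1 = Polynomial.X - C (a 0))
    (hrec : ∀ n, q (n + 2) = (Polynomial.X - C (a (n + 1))) * q (n + 1) - C (b (n + 1)) * q n)
    (hk0 : k 0 = 1) (hk1 : k 1 = Polynomial.X - C (a' 0)) (hkrec : ∀ n, k (n + 2) = (Polynomial.X - C (a' (n + 1))) * k (n + 1) - C (b' (n + 1)) * k n)
    (ha0 : a 0 = c 1) (ha : ∀ n, a (n + 1) = c (2 * n + 2) + c (2 * n + 3)) (hb : ∀ n, b (n + 1) = c (2 * n + 1) * c (2 * n + 2))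
    (ha' : ∀ n, a' n = c (2 * n + 1) + c (2 * n + 2)) (hb' : ∀ n, b' (n + 1) = c (2 * n + 2) * c (2 * n + 3)) :
    ∀ n, q (n + 1) = Polynomial.X * k n - C (c (2 * n + 1)) * q n ∧ k (n + 1) = q (n + 1) - C (c (2 * n + 2)) * k n := by
  intro n
  induction n with
  | zero =>
    refine ⟨by rw [hq1, hk0, hq0, ha0, mul_one, mul_one], ?_⟩
    rw [hk1, hq1, hk0, ha', ha0, mul_one, map_add]
    ring
  | succ n ih =>
    obtain ⟨h1, h2⟩ := ih
    have e1 : q (n + 1 + 1) = Polynomial.X * k (n + 1) - C (c (2 * (n + 1) + 1)) * q (n + 1) := by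
      rw [show n + 1 + 1 = n + 2 from rfl, hrec n, ha n, hb n, h2, map_add, map_mul, show 2 * (n + 1) + 1 = 2 * n + 3 by ring]
      linear_combination (-(C (c (2 * n + 2)))) * h1
    refine ⟨e1, ?_⟩
    rw [show n + 1 + 1 = n + 2 from rfl, hkrec n, ha' (n + 1), hb' n, map_add, map_mul, show 2 * (n + 1) + 1 = 2 * n + 3 by ring, show 2 * (n + 1) + 2 = 2 * n + 4 by ring] at *
    rw [e1, h2]
    ring

/-- **SYMMETRIZATION: `S_{2n} = q_n(X²)` and `S_{2n+1} = X · k_n(X²)`** for the symmetric recurrence `S_0 = 1`, `S_1 = X`, `S_{n+2} = X S_{n+1} − c_{n+1} S_n`. [Chihara I Thm 8.1, §9; this file,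
§1139] -/
theorem symmetrization_even_odd {S q k : ℕ → ℝ[X]} {aS bS a b a' b' c : ℕ → ℝ} (hS0 : S 0 = 1) (hS1 : S 1 = Polynomial.X - C (aS 0))
    (hSrec : ∀ n, S (n + 2) = (Polynomial.X - C (aS (n + 1))) * S (n + 1) - C (bS (n + 1)) * S n) (haS : ∀ n, aS n = 0) (hbS : ∀ n, bS (n + 1) = c (n + 1))
    (hq0 : q 0 = 1) (hq1 : q 1 = Polynomial.X - C (a 0)) (hrec : ∀ n, q (n + 2) = (Polynomial.X - C (a (n + 1))) * q (n + 1) - C (b (n + 1)) * q n)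
    (hk0 : k 0 = 1) (hk1 : k 1 = Polynomial.X - C (a' 0)) (hkrec : ∀ n, k (n + 2) = (Polynomial.X - C (a' (n + 1))) * k (n + 1) - C (b' (n + 1)) * k n)
    (ha0 : a 0 = c 1) (ha : ∀ n, a (n + 1) = c (2 * n + 2) + c (2 * n + 3)) (hb : ∀ n, b (n + 1) = c (2 * n + 1) * c (2 * n + 2))
    (ha' : ∀ n, a' n = c (2 * n + 1) + c (2 * n + 2)) (hb' : ∀ n, b' (n + 1) = c (2 * n + 2) * c (2 * n + 3)) :
    ∀ n, S (2 * n) = (q n).comp (Polynomial.X ^ 2) ∧ S (2 * n + 1) = Polynomial.X * (k n).comp (Polynomial.X ^ 2) := by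
  have hid := stieltjes_kernel_identities hq0 hq1 hrec hk0 hk1 hkrec ha0 ha hb ha' hb'
  intro n
  induction n with
  | zero => exact ⟨by rw [mul_zero, hS0, hq0, one_comp], by rw [mul_zero, zero_add, hS1, haS, C_0, sub_zero, hk0, one_comp, mul_one]⟩
  | succ n ih =>
    obtain ⟨h0, h1⟩ := ih
    obtain ⟨i1, i2⟩ := hid n
    have e0 : S (2 * (n + 1)) = (q (n + 1)).comp (Polynomial.X ^ 2) := by
      rw [show 2 * (n + 1) = 2 * n + 2 by ring, hSrec, haS, C_0, sub_zero, hbS, h1, h0, i1, sub_comp, mul_comp, mul_comp, X_comp, C_comp]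
      ring
    refine ⟨e0, ?_⟩
    rw [show 2 * (n + 1) + 1 = (2 * n + 1) + 2 by ring, hSrec, haS, C_0, sub_zero, show 2 * n + 1 + 1 = 2 * (n + 1) by ring, e0, show 2 * (n + 1) = (2 * n + 1) + 1 by ring, hbS, h1, i2,
      sub_comp, mul_comp, C_comp, show 2 * n + 1 + 1 = 2 * n + 2 by ring]
    ring

/-- **`(∏_i (X − z_i))(X²) = ∏_i (X − √z_i) · ∏_i (X − (−√z_i))` when every `z_i ≥ 0`.** [bookkeeping; this file, §1139] -/
theorem comp_X_sq_prod_eq {m : ℕ} {z : Fin m → ℝ} (hz : ∀ i, 0 ≤ z i) :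
    (∏ i, (Polynomial.X - C (z i))).comp (Polynomial.X ^ 2) = (∏ i, (Polynomial.X - C (Real.sqrt (z i)))) * ∏ i, (Polynomial.X - C (-Real.sqrt (z i))) := by
  rw [prod_comp, ← Finset.prod_mul_distrib]
  refine Finset.prod_congr rfl fun i _ => ?_
  rw [sub_comp, X_comp, C_comp, map_neg]
  have h : C (z i) = C (Real.sqrt (z i)) * C (Real.sqrt (z i)) := by rw [← map_mul, Real.mul_self_sqrt (hz i)]
  rw [h]
  ring

/-- **THE ZEROS OF `S_{2n}` ARE `±√z_i`: if `q_n = ∏ (X − z_i)` with `z_i ≥ 0` then `S_{2n} = ∏ (X − √z_i) · ∏ (X − (−√z_i))`.** [Chihara I Thm 8.1 ∕ Thm 9.1; this file, §1139] -/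
theorem symmetrization_even_zeros {S q k : ℕ → ℝ[X]} {aS bS a b a' b' c : ℕ → ℝ} (hS0 : S 0 = 1) (hS1 : S 1 = Polynomial.X - C (aS 0))
    (hSrec : ∀ n, S (n + 2) = (Polynomial.X - C (aS (n + 1))) * S (n + 1) - C (bS (n + 1)) * S n) (haS : ∀ n, aS n = 0) (hbS : ∀ n, bS (n + 1) = c (n + 1))
    (hq0 : q 0 = 1) (hq1 : q 1 = Polynomial.X - C (a 0)) (hrec : ∀ n, q (n + 2) = (Polynomial.X - C (a (n + 1))) * q (n + 1) - C (b (n + 1)) * q n)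
    (hk0 : k 0 = 1) (hk1 : k 1 = Polynomial.X - C (a' 0)) (hkrec : ∀ n, k (n + 2) = (Polynomial.X - C (a' (n + 1))) * k (n + 1) - C (b' (n + 1)) * k n)
    (ha0 : a 0 = c 1) (ha : ∀ n, a (n + 1) = c (2 * n + 2) + c (2 * n + 3)) (hb : ∀ n, b (n + 1) = c (2 * n + 1) * c (2 * n + 2))
    (ha' : ∀ n, a' n = c (2 * n + 1) + c (2 * n + 2)) (hb' : ∀ n, b' (n + 1) = c (2 * n + 2) * c (2 * n + 3))
    {n : ℕ} {z : Fin n → ℝ} (hz : ∀ i, 0 ≤ z i) (hzq : q n = ∏ i, (Polynomial.X - C (z i))) :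
    S (2 * n) = (∏ i, (Polynomial.X - C (Real.sqrt (z i)))) * ∏ i, (Polynomial.X - C (-Real.sqrt (z i))) := by
  rw [(symmetrization_even_odd hS0 hS1 hSrec haS hbS hq0 hq1 hrec hk0 hk1 hkrec ha0 ha hb ha' hb' n).1, hzq]
  exact comp_X_sq_prod_eq hz

end Summit.Ventures.HSemireg.Wedge.HankelOuter
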